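import Mathlib
import Literature.Probability.Percolation.DiagonalStripWheelVanishing
import Literature.Probability.Percolation.DiagonalStripPairingSymmetry
import HarnessLib

/-!
# Symmetries of the sum `Z = Σ_Q ψ_Q` and transfer of degree bounds to the primitive ground state

Topic `Literature/Probability/Percolation`. Small structural facts about the ground state of the
loop-weight-one transfer matrix of Ikhlef–Ponsaing (J. Stat. Phys. 149 (2012), arXiv:1202.5476, §3.4,
§3.6) in the cluster language of this development, needed by the normalisation argument of
Prop. 3.4 (`Z_L = χ_L(z²)`):

* `exch_coeff_sum` — `[q z_{i+1}/z_i] = [q z_i/z_{i+1}] + [z_i/z_{i+1}]` at `q² + q + 1 = 0`;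
* `IsExactExchange.genSwap_ipZsum` — an exact exchange relation at level `i` (for ANY lumped move
  `g`, no adjointness needed) makes `Z = Σ ψ` invariant under `σ_i`; in particular `Z` of the exact
  ground state of `DiagonalStripQKZExact` is symmetric in `z_1, …, z_L` (all `1 ≤ i ≤ 2m`);
* `genInv_ipZsum_of_zpow` — a monomial reflection `ι_k ψ = z_k^{2a} ψ` passes to `Z`;
* `hypSubst_wheel_ipZsum` — the wheel vanishing of `DiagonalStripWheelVanishing` passes to `Z`;
* `PolyPrimitive.exists_eq_C_mul_of_fixed`, `PolyPrimitive.degreeOf_le_of_fixed` — by generic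
  simplicity every polynomial `t`-fixed vector is a POLYNOMIAL multiple `C₀ • P` of the primitive one,
  so any degree bound exhibited by one polynomial fixed vector holds for the primitive ground state
  (this is how a minimal-degree polynomial solution transfers its degree to `P`).

## References

* Y. Ikhlef, A. K. Ponsaing, *Finite-size left-passage probability in percolation*, J. Stat. Phys.
  149 (2012) 10–36, arXiv:1202.5476, §3.4, §3.6. [IkhlefPonsaing2012]
-/

namespace Literature.Probability.Percolation

open Finset Literature.Probability.LatticeModels Literature.Probability.LatticeModels.TemperleyLieb

/-! ### `σ_i`-invariance of the sum from an exact exchange relation -/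

section SumSymmetry

open MvPolynomial

variable {K₀ : Type*} [Field K₀] {m : ℕ}

/-- `[q z_{i+1}/z_i] = [q z_i/z_{i+1}] + [z_i/z_{i+1}]` (from `[cx] + [x] = [c/x]` at `c² + c + 1 = 0`).
[folklore] -/
theorem exch_coeff_sum {q : K₀} (hq : q ^ 2 + q + 1 = 0) (i : ℕ) :
    qbr (genC K₀ q * genZ K₀ (i + 1) / genZ K₀ i) =
      qbr (genC K₀ q * genZ K₀ i / genZ K₀ (i + 1)) + qbr (genZ K₀ i / genZ K₀ (i + 1)) := by
  have h := qbr_quad_identity (genC_quad hq) (genZ K₀ i / genZ K₀ (i + 1))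
  rw [div_div_eq_mul_div] at h
  rw [← h, mul_div_assoc]

/-- **`σ_i Z = Z` from the exact exchange relation at level `i`** (any lumped move `g`: the
push-forward preserves the sum). [cite: IkhlefPonsaing2012, §3.6] -/
theorem IsExactExchange.genSwap_ipZsum {q : K₀} (hq : q ^ 2 + q + 1 = 0) {i : ℕ} {g : ColPattern m → ColPattern m}
    {ψ : ColPattern m → RapidityField K₀} (hex : IsExactExchange q i g ψ) :
    genSwap K₀ i (ipZsum ψ) = ipZsum ψ := by
  have hq0 : q ≠ 0 := by rintro rfl; norm_num at hq
  have key := Finset.sum_congr rfl fun Q (_ : Q ∈ (Finset.univ : Finset (ColPattern m))) => hex Q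
  rw [Finset.sum_sub_distrib, ← Finset.mul_sum, ← Finset.mul_sum, sum_ipPush, ← Finset.mul_sum, ← map_sum,
    exch_coeff_sum hq] at key
  have hC : qbr (genC K₀ q * genZ K₀ i / genZ K₀ (i + 1)) ≠ 0 := by
    rw [mul_div_assoc]; exact qbr_genC_mul_ratio_ne_zero hq0 i
  unfold ipZsum
  have h0 : qbr (genC K₀ q * genZ K₀ i / genZ K₀ (i + 1)) * (genSwap K₀ i (∑ Q, ψ Q) - ∑ Q, ψ Q) = 0 := by
    linear_combination -key
  exact (sub_eq_zero.1 ((mul_eq_zero.1 h0).resolve_left hC))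

/-- A monomial reflection of the components passes to the sum. [folklore] -/
theorem genInv_ipZsum_of_zpow {k : ℕ} {a : ℤ} {ψ : ColPattern m → RapidityField K₀}
    (h : ∀ Q, genInv K₀ k (ψ Q) = genZ K₀ k ^ (2 * a) * ψ Q) :
    genInv K₀ k (ipZsum ψ) = genZ K₀ k ^ (2 * a) * ipZsum ψ := by
  unfold ipZsum
  rw [map_sum, Finset.mul_sum]
  exact Finset.sum_congr rfl fun Q _ => h Q

end SumSymmetry

/-! ### Wheel vanishing of the sum -/

section WheelSum

open MvPolynomial

variable {n : ℕ}

/-- **The polynomial sum `Σ_Q P_Q` vanishes under `z_2 = q z_1`, `z_3 = q z_2`.**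
[cite: IkhlefPonsaing2012, §3.4–3.6] -/
theorem hypSubst_wheel_ipZsum {q : ℂ} (hq : q ^ 2 + q + 1 = 0) {P : ColPattern (n + 1) → MvPolynomial ℕ ℂ}
    (hP : ∀ Q', ∑ Q, ipTransferMatrixW (n + 1) (genC ℂ q) (genW ℂ) (genZ ℂ) Q Q' * toRF ℂ (P Q) = toRF ℂ (P Q')) :
    hypSubst q 1 (hypSubst q 2 (∑ Q, P Q)) = 0 := by
  rw [map_sum, map_sum]
  exact Finset.sum_eq_zero fun Q _ => groundState_wheel_vanishing hq hP Q

end WheelSum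

/-! ### Every polynomial fixed vector is a polynomial multiple of the primitive one -/

section DegreeTransfer

open MvPolynomial

variable {m : ℕ}

/-- **`Ψ' = C₀ • P`**: by generic simplicity a polynomial `t`-fixed vector is proportional to the
primitive one, and primitivity makes the scalar a polynomial. [folklore] -/
theorem PolyPrimitive.exists_eq_C_mul_of_fixed {q : ℂ} (hq : q ^ 2 + q + 1 = 0)
    {P : ColPattern m → MvPolynomial ℕ ℂ} (hprim : PolyPrimitive P)
    (hP : ∀ Q', ∑ Q, ipTransferMatrixW m (genC ℂ q) (genW ℂ) (genZ ℂ) Q Q' * toRF ℂ (P Q) = toRF ℂ (P Q'))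
    {Ψ' : ColPattern m → MvPolynomial ℕ ℂ}
    (hΨ' : ∀ Q', ∑ Q, ipTransferMatrixW m (genC ℂ q) (genW ℂ) (genZ ℂ) Q Q' * toRF ℂ (Ψ' Q) = toRF ℂ (Ψ' Q')) :
    ∃ C₀ : MvPolynomial ℕ ℂ, ∀ Q, Ψ' Q = C₀ * P Q := by
  have hP0 : (fun Q => toRF ℂ (P Q)) ≠ 0 := by
    obtain ⟨Q₀, hQ₀⟩ := hprim.exists_ne_zero
    intro h; exact hQ₀ (toRF_injective ((congrFun h Q₀).trans (map_zero _).symm))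
  obtain ⟨c, hc⟩ := exists_scalar_of_proportional (fun k => ipTransferMatrixW_fixed_proportional hq hP hΨ' k) hP0
  obtain ⟨C₀, rfl⟩ := hprim.exists_eq_toRF (c := c) fun Q => ⟨Ψ' Q, (hc Q).symm⟩
  exact ⟨C₀, fun Q => toRF_injective (by rw [map_mul]; exact hc Q)⟩

/-- **Degree transfer**: every variable degree of the primitive ground state is bounded by that of any
nonzero polynomial `t`-fixed vector. [folklore] -/
theorem PolyPrimitive.degreeOf_le_of_fixed {q : ℂ} (hq : q ^ 2 + q + 1 = 0)
    {P : ColPattern m → MvPolynomial ℕ ℂ} (hprim : PolyPrimitive P)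
    (hP : ∀ Q', ∑ Q, ipTransferMatrixW m (genC ℂ q) (genW ℂ) (genZ ℂ) Q Q' * toRF ℂ (P Q) = toRF ℂ (P Q'))
    {Ψ' : ColPattern m → MvPolynomial ℕ ℂ} (hΨ'0 : Ψ' ≠ 0)
    (hΨ' : ∀ Q', ∑ Q, ipTransferMatrixW m (genC ℂ q) (genW ℂ) (genZ ℂ) Q Q' * toRF ℂ (Ψ' Q) = toRF ℂ (Ψ' Q'))
    (k : ℕ) (Q : ColPattern m) : (P Q).degreeOf k ≤ (Ψ' Q).degreeOf k := by
  obtain ⟨C₀, hC₀⟩ := hprim.exists_eq_C_mul_of_fixed hq hP hΨ'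
  have hC0 : C₀ ≠ 0 := by
    rintro rfl
    exact hΨ'0 (funext fun Q => by rw [hC₀ Q, zero_mul]; rfl)
  by_cases hPQ : P Q = 0
  · rw [hPQ, degreeOf_zero]; exact Nat.zero_le _
  rw [hC₀ Q, degreeOf_mul_eq hC0 hPQ]
  exact Nat.le_add_left _ _

/-- The same transfer for the JOINT degree in two variables `i, j`, measured through the monomial
substitution `X_j ↦ X_i X_j` (which adds the `X_j`-exponent to the `X_i`-exponent of every monomial):
`deg_{X_i}` after the substitution bounds `s(i) + s(j)` over the support. [folklore] -/
theorem PolyPrimitive.degreeOf_pairSubst_le_of_fixed {q : ℂ} (hq : q ^ 2 + q + 1 = 0)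
    {P : ColPattern m → MvPolynomial ℕ ℂ} (hprim : PolyPrimitive P)
    (hP : ∀ Q', ∑ Q, ipTransferMatrixW m (genC ℂ q) (genW ℂ) (genZ ℂ) Q Q' * toRF ℂ (P Q) = toRF ℂ (P Q'))
    {Ψ' : ColPattern m → MvPolynomial ℕ ℂ}
    (hΨ' : ∀ Q', ∑ Q, ipTransferMatrixW m (genC ℂ q) (genW ℂ) (genZ ℂ) Q Q' * toRF ℂ (Ψ' Q) = toRF ℂ (Ψ' Q'))
    (θ : MvPolynomial ℕ ℂ →+* MvPolynomial ℕ ℂ) (hθ : ∀ Q, θ (Ψ' Q) ≠ 0) (k : ℕ) (Q : ColPattern m) :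
    (θ (P Q)).degreeOf k ≤ (θ (Ψ' Q)).degreeOf k := by
  obtain ⟨C₀, hC₀⟩ := hprim.exists_eq_C_mul_of_fixed hq hP hΨ'
  have h1 : θ (Ψ' Q) = θ C₀ * θ (P Q) := by rw [hC₀ Q, map_mul]
  have hC0 : θ C₀ ≠ 0 := fun h => hθ Q (by rw [h1, h, zero_mul])
  have hPQ : θ (P Q) ≠ 0 := fun h => hθ Q (by rw [h1, h, mul_zero])
  rw [h1, degreeOf_mul_eq hC0 hPQ]
  exact Nat.le_add_left _ _

end DegreeTransfer

end Literature.Probability.Percolation
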